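import Literature.NumberTheory.EllipticCurves.EichlerShimuraPeriods
import Mathlib.NumberTheory.ModularForms.Cusps
import HarnessLib

/-!
# Route `ManinLocalTwoThree` — definitions posited by the cusp-symbol programme (Hecke operators on symbols)

Summit `BirchSwinnertonDyer`, route `ManinLocalTwoThree` (cell bsd-f2-manin), cruxes C2 `ManinOddAtFour`
(stmt-BirchSwinnertonDyer-22967) and C3 `ManinPrimeToThreeAtNine` (stmt-BirchSwinnertonDyer-22968): the relative
Ihara statement `RelativeIharaShiftVanishingBar` behind both generation stubs is attacked through CUSP SYMBOLS
`Φ : P¹(ℚ) × P¹(ℚ) → K` (planner memo HOME/MEMO-es.md §22–§23; symbol layer landed in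
`Theorems/ManinLocalTwoThreeCuspSymbolBoundary.lean`).  This small definitions file (the route's `Defs` file,
D-0016) fixes the ONE piece of vocabulary that statements must share BY NAME: the Hecke operator `T_p` on symbols
and on functions of one cusp, built from the tree's coset representatives `heckeRep p i` (`βⱼ = (1 j; 0 p)`,
`β_∞ = diag(p,1)`, index set `HeckeIdx N p`, Diamond–Shurman (5.2)) acting on Mathlib's `OnePoint ℚ` through
`GL₂(ℚ)` (`OnePoint.instGLAction`).  The index set is the level-`N` one of the tree's cocycle operator
`HidaCohomology.heckeU n N R hp` (Shimura (8.3.2)), so that the boundary map `Φ ↦ (γ ↦ Φ(∞, γ∞))` intertwines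
`symbolHecke N p K` with `heckeU 0 N K hp` (proved downstream, from `heckePermElt_spec`).

Contents: `heckeRepGL p i ∈ GL₂(ℚ)` (the rational matrix of `heckeRep p i`, determinant `p ≠ 0`) with its entries
and `heckeRepGL p i • ∞ = ∞`; `cuspFunHecke N p K : (P¹(ℚ) → K) →ₗ (P¹(ℚ) → K)`, `(T w)(x) = Σᵢ w(βᵢ x)`;
`symbolHecke N p K : (P¹(ℚ)² → K) →ₗ (P¹(ℚ)² → K)`, `(T Φ)(a,b) = Σᵢ Φ(βᵢ a, βᵢ b)`; and the tautology
`symbolHecke` of a boundary symbol `w(b) − w(a)` is the boundary symbol of `cuspFunHecke w`.  Definitions with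
bodies and unfolding lemmas only; nothing about BSD or Manin's conjecture is asserted or proved here.

References: F. Diamond, J. Shurman, *A first course in modular forms*, GTM 228, §5.2 (5.2), Prop. 5.2.1
[cite: DiamondShurman2005, §5.2 (5.2)]; G. Shimura, *Introduction to the arithmetic theory of automorphic
functions* (1971) §8.3 (8.3.2) [cite: Shimura1971, §8.3 (8.3.2)]; L. Merel, *Universal Fourier expansions of
modular forms*, LNM 1585 (1994) §1.2–1.3 (Hecke operators on symbols `{a,b}` through `Σ Φ∣βᵢ`); cell memo
MEMO-es §22.2 («`T_r` on symbols by the `r+1` standard representatives; it commutes with `δ`»).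
-/

set_option autoImplicit false
set_option linter.dupNamespace false

noncomputable section

open scoped MatrixGroups

open CongruenceSubgroup Literature.NumberTheory.EllipticCurves.ModularForms

namespace Summit.BirchSwinnertonDyer.BirchSwinnertonDyer.Theorems.ManinLocalTwoThree

/-! ### The Hecke representatives as elements of `GL₂(ℚ)` -/

section Rep

variable (p : ℕ) [NeZero p]

/-- `det βᵢ = p ≠ 0` for the rational matrix of `heckeRep p i`. [cite: DiamondShurman2005, §5.2 (5.2)] -/
theorem det_map_heckeRep_ne_zero (i : Option (ZMod p)) :
    ((heckeRep p i).map (Int.castRingHom ℚ)).det ≠ 0 := by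
  rw [← RingHom.mapMatrix_apply, ← RingHom.map_det, det_heckeRep, map_natCast]
  exact_mod_cast NeZero.ne p

/-- **`β̃ᵢ ∈ GL₂(ℚ)`**: the Hecke representative `heckeRep p i` (`(1 j; 0 p)` for `i = some j`, `diag(p,1)` for
`i = none`) as an invertible rational matrix, so that it acts on `P¹(ℚ) = OnePoint ℚ` by Möbius transformations
(`OnePoint.instGLAction`). [cite: DiamondShurman2005, §5.2 (5.2)] -/
def heckeRepGL (i : Option (ZMod p)) : GL (Fin 2) ℚ :=
  Matrix.GeneralLinearGroup.mkOfDetNeZero _ (det_map_heckeRep_ne_zero p i)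

/-- The matrix of `heckeRepGL p i` is the rational image of `heckeRep p i`. [cite: DiamondShurman2005, §5.2 (5.2)] -/
@[simp] theorem coe_heckeRepGL (i : Option (ZMod p)) :
    ((heckeRepGL p i : GL (Fin 2) ℚ) : Matrix (Fin 2) (Fin 2) ℚ) = (heckeRep p i).map (Int.castRingHom ℚ) := rfl

/-- Entries of `β̃ⱼ = (1 j; 0 p)`. [cite: DiamondShurman2005, §5.2 (5.2)] -/
theorem heckeRepGL_some_apply (j : ZMod p) :
    (heckeRepGL p (some j) : GL (Fin 2) ℚ) 0 0 = 1 ∧ (heckeRepGL p (some j) : GL (Fin 2) ℚ) 0 1 = (j.val : ℚ) ∧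
      (heckeRepGL p (some j) : GL (Fin 2) ℚ) 1 0 = 0 ∧ (heckeRepGL p (some j) : GL (Fin 2) ℚ) 1 1 = (p : ℚ) := by
  refine ⟨?_, ?_, ?_, ?_⟩ <;> simp [heckeRepGL, Matrix.GeneralLinearGroup.mkOfDetNeZero, heckeRep]

/-- Entries of `β̃_∞ = diag(p, 1)`. [cite: DiamondShurman2005, §5.2 (5.2)] -/
theorem heckeRepGL_none_apply :
    (heckeRepGL p none : GL (Fin 2) ℚ) 0 0 = (p : ℚ) ∧ (heckeRepGL p none : GL (Fin 2) ℚ) 0 1 = 0 ∧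
      (heckeRepGL p none : GL (Fin 2) ℚ) 1 0 = 0 ∧ (heckeRepGL p none : GL (Fin 2) ℚ) 1 1 = 1 := by
  refine ⟨?_, ?_, ?_, ?_⟩ <;> simp [heckeRepGL, Matrix.GeneralLinearGroup.mkOfDetNeZero, heckeRep]

/-- The lower-left entry of every `β̃ᵢ` vanishes (both are upper triangular). [cite: DiamondShurman2005, §5.2 (5.2)] -/
@[simp] theorem heckeRepGL_apply_one_zero (i : Option (ZMod p)) : (heckeRepGL p i : GL (Fin 2) ℚ) 1 0 = 0 := by
  cases i with
  | none => exact (heckeRepGL_none_apply p).2.2.1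
  | some j => exact (heckeRepGL_some_apply p j).2.2.1

/-- **Every `β̃ᵢ` fixes the cusp `∞`** (upper triangular). [cite: DiamondShurman2005, §5.2 (5.2)] -/
@[simp] theorem heckeRepGL_smul_infty (i : Option (ZMod p)) :
    (heckeRepGL p i : GL (Fin 2) ℚ) • (OnePoint.infty : OnePoint ℚ) = OnePoint.infty := by
  rw [OnePoint.smul_infty_eq_self_iff]
  exact heckeRepGL_apply_one_zero p i

end Rep

/-! ### Hecke operators on functions of cusps and on symbols -/

section Hecke

variable (N p : ℕ) [NeZero p] (K : Type*) [CommRing K]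

/-- **`T_p` on functions of ONE cusp** (level-`N` index set `HeckeIdx N p`): `(T w)(x) = Σᵢ w(β̃ᵢ x)` — the
action of the double coset `Γ₀(N) diag(1,p) Γ₀(N) = ⊔ᵢ Γ₀(N) βᵢ` on functions on `P¹(ℚ)` (it preserves
`Γ₀(N)`-invariant functions for `p ∤ N`; on boundary symbols `w(b) − w(a)` it induces `symbolHecke`,
`symbolHecke_boundary`). [cite: Shimura1971, §8.3 (8.3.2)] -/
def cuspFunHecke : Module.End K (OnePoint ℚ → K) where
  toFun w x := ∑ i : HeckeIdx N p, w (heckeRepGL p i.1 • x)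
  map_add' w w' := by
    funext x
    simp only [Pi.add_apply, Finset.sum_add_distrib]
  map_smul' c w := by
    funext x
    simp only [Pi.smul_apply, RingHom.id_apply, Finset.smul_sum]

/-- Unfolding `cuspFunHecke`. [cite: Shimura1971, §8.3 (8.3.2)] -/
@[simp] theorem cuspFunHecke_apply (w : OnePoint ℚ → K) (x : OnePoint ℚ) :
    cuspFunHecke N p K w x = ∑ i : HeckeIdx N p, w (heckeRepGL p i.1 • x) := rfl

/-- **`T_p` on symbols** (functions of two cusps; level-`N` index set `HeckeIdx N p`):
`(T Φ)(a, b) = Σᵢ Φ(β̃ᵢ a, β̃ᵢ b)` — Merel's / Shimura's action of the Hecke correspondence on symbols `{a, b}`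
by the standard representatives; for a `Γ₀(N)`-invariant symbol its boundary map `γ ↦ (TΦ)(∞, γ∞)` is
`heckeU 0 N K hp` of the boundary map of `Φ` (downstream, from `heckePermElt_spec`). [cite: Shimura1971, §8.3 (8.3.2)] -/
def symbolHecke : Module.End K (OnePoint ℚ → OnePoint ℚ → K) where
  toFun Φ a b := ∑ i : HeckeIdx N p, Φ (heckeRepGL p i.1 • a) (heckeRepGL p i.1 • b)
  map_add' Φ Ψ := by
    funext a b
    simp only [Pi.add_apply, Finset.sum_add_distrib]
  map_smul' c Φ := by
    funext a b
    simp only [Pi.smul_apply, RingHom.id_apply, Finset.smul_sum]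

/-- Unfolding `symbolHecke`. [cite: Shimura1971, §8.3 (8.3.2)] -/
@[simp] theorem symbolHecke_apply (Φ : OnePoint ℚ → OnePoint ℚ → K) (a b : OnePoint ℚ) :
    symbolHecke N p K Φ a b = ∑ i : HeckeIdx N p, Φ (heckeRepGL p i.1 • a) (heckeRepGL p i.1 • b) := rfl

/-- **`T_p` of a boundary symbol is the boundary symbol of `T_p w`**: `T(w(b) − w(a)) = (Tw)(b) − (Tw)(a)`.
[cite: Shimura1971, §8.3 (8.3.2)] -/
theorem symbolHecke_boundary (w : OnePoint ℚ → K) :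
    symbolHecke N p K (fun a b ↦ w b - w a) = fun a b ↦ cuspFunHecke N p K w b - cuspFunHecke N p K w a := by
  funext a b
  simp only [symbolHecke_apply, cuspFunHecke_apply, Finset.sum_sub_distrib]

/-- `T_p` preserves the symbol relation `Φ(a,b) + Φ(b,c) = Φ(a,c)`. [cite: Shimura1971, §8.3 (8.3.2)] -/
theorem symbolHecke_isSymbol {Φ : OnePoint ℚ → OnePoint ℚ → K} (hsym : ∀ a b c, Φ a b + Φ b c = Φ a c) :
    ∀ a b c, symbolHecke N p K Φ a b + symbolHecke N p K Φ b c = symbolHecke N p K Φ a c := by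
  intro a b c
  simp only [symbolHecke_apply, ← Finset.sum_add_distrib, hsym]

end Hecke


/-! ### Cusp representatives and the two distinguished Hecke neighbours (appended 2026-08-28, p2 g4)

For E-es-30 (`BoundaryEisenstein`): on `Γ₀(M)`-invariant functions of cusps, `T_r = ρ_r + r ρ_r⁻¹` where, for a cusp
`x = g∞` (`g = (a b; c d) ∈ SL₂(ℤ)`), `ρ_r x` is the neighbour `βᵢ x` with `σ(i) = ∞` — class of the bottom row
`(c, r d)` — and `ρ_r⁻¹ x` any neighbour with `σ(i) ≠ ∞` — class `(r c, d)` (Shimura (8.3.2) permutation data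
`βᵢ g = g'ᵢ β_{σ(i)}` at level `1`, tree `heckePerm` / `heckePermElt` / `heckePermEquiv`;
`Theorems/ManinLocalTwoThreeHeckeNeighbours.lean`).  The two point maps below are those neighbours, computed from a
CHOSEN matrix `cuspMatrix x` with `cuspMatrix x · ∞ = x` (Mathlib `OnePoint.exists_mem_SL2`: `SL₂(ℤ)` is transitive on
`P¹(ℚ)`); they are well defined on `Γ₀(M)`-orbits for every `M` prime to `r` (downstream). -/

section Neighbours

/-- **A matrix of `SL₂(ℤ)` carrying `∞` to the cusp `x`** (a choice; `P¹(ℚ) = SL₂(ℤ)·∞`, Mathlib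
`OnePoint.exists_mem_SL2`). [cite: Shimura1971, §1.6] -/
def cuspMatrix (x : OnePoint ℚ) : SL(2, ℤ) :=
  Classical.choose (OnePoint.exists_mem_SL2 ℤ x)

/-- Defining property of `cuspMatrix`: `cuspMatrix x · ∞ = x`. [cite: Shimura1971, §1.6] -/
@[simp] theorem cuspMatrix_smul_infty (x : OnePoint ℚ) :
    (Matrix.SpecialLinearGroup.mapGL ℚ (cuspMatrix x) : GL (Fin 2) ℚ) • (OnePoint.infty : OnePoint ℚ) = x :=
  Classical.choose_spec (OnePoint.exists_mem_SL2 ℤ x)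

/-- Every element of `SL₂(ℤ)` lies in `Γ₀(1)` (plumbing: the tree's Hecke permutation data are indexed by `Γ₀(N)`).
[folklore] -/
theorem mem_Gamma0_one (g : SL(2, ℤ)) : g ∈ Gamma0 1 := by
  rw [Gamma0_mem]
  exact Subsingleton.elim _ _

/-- `cuspMatrix x` as an element of `Γ₀(1)`. [cite: Shimura1971, §1.6] -/
def cuspMatrix₁ (x : OnePoint ℚ) : Gamma0 1 :=
  ⟨cuspMatrix x, mem_Gamma0_one _⟩

/-- Unfolding `cuspMatrix₁`. [folklore] -/
@[simp] theorem coe_cuspMatrix₁ (x : OnePoint ℚ) : ((cuspMatrix₁ x : Gamma0 1) : SL(2, ℤ)) = cuspMatrix x := rfl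

variable {r : ℕ} [NeZero r]

omit [NeZero r] in
/-- At level `1` every index of `Option (ZMod r)` is a Hecke index (`r ∤ 1` for a prime `r`). [folklore] -/
theorem heckeIdx_one_cond (hr : r.Prime) (o : Option (ZMod r)) : o = none → ¬ r ∣ 1 :=
  fun _ h ↦ (Nat.Prime.one_lt hr).ne' (Nat.dvd_one.mp h)

/-- The Hecke index `i` at level `1` with `σ_g(i) = o` (`σ_g = heckePerm hr g` is a bijection, `heckePermEquiv`).
[cite: Shimura1971, §8.3 p. 237] -/
def heckeIdxPre (hr : r.Prime) (g : Gamma0 1) (o : Option (ZMod r)) : HeckeIdx 1 r :=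
  (heckePermEquiv hr g).symm ⟨o, heckeIdx_one_cond hr o⟩

/-- Defining property of `heckeIdxPre`: `σ_g(heckeIdxPre g o) = o`. [cite: Shimura1971, §8.3 p. 237] -/
@[simp] theorem heckePerm_heckeIdxPre (hr : r.Prime) (g : Gamma0 1) (o : Option (ZMod r)) :
    (heckePerm hr g (heckeIdxPre hr g o)).1 = o := by
  have h := (heckePermEquiv hr g).apply_symm_apply ⟨o, heckeIdx_one_cond hr o⟩
  rw [heckePermEquiv_apply] at h
  rw [heckeIdxPre, h]

/-- **The `∞`-neighbour `ρ_r x`** of a cusp `x = g∞` (`g = cuspMatrix x`): the point `βᵢ x = g'ᵢ ∞` for the unique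
Hecke index `i` with `σ_g(i) = ∞`; its bottom-row class is that of `(c, r d)`. [cite: Shimura1971, §8.3 (8.3.2)] -/
def heckeNbrInfty (hr : r.Prime) (x : OnePoint ℚ) : OnePoint ℚ :=
  (Matrix.SpecialLinearGroup.mapGL ℚ
      ((heckePermElt hr (cuspMatrix₁ x) (heckeIdxPre hr (cuspMatrix₁ x) none) : Gamma0 1) : SL(2, ℤ)) :
    GL (Fin 2) ℚ) • (OnePoint.infty : OnePoint ℚ)

/-- **The `0`-neighbour `ρ_r⁻¹ x`** of a cusp `x = g∞` (`g = cuspMatrix x`): the point `βᵢ x = g'ᵢ ∞` for the Hecke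
index `i` with `σ_g(i) = 0` (any index with `σ_g(i) ≠ ∞` gives the same `Γ₀(M)`-class, that of `(r c, d)`).
[cite: Shimura1971, §8.3 (8.3.2)] -/
def heckeNbrZero (hr : r.Prime) (x : OnePoint ℚ) : OnePoint ℚ :=
  (Matrix.SpecialLinearGroup.mapGL ℚ
      ((heckePermElt hr (cuspMatrix₁ x) (heckeIdxPre hr (cuspMatrix₁ x) (some 0)) : Gamma0 1) : SL(2, ℤ)) :
    GL (Fin 2) ℚ) • (OnePoint.infty : OnePoint ℚ)

/-- Unfolding `heckeNbrInfty`. [cite: Shimura1971, §8.3 (8.3.2)] -/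
theorem heckeNbrInfty_def (hr : r.Prime) (x : OnePoint ℚ) : heckeNbrInfty hr x =
    (Matrix.SpecialLinearGroup.mapGL ℚ
      ((heckePermElt hr (cuspMatrix₁ x) (heckeIdxPre hr (cuspMatrix₁ x) none) : Gamma0 1) : SL(2, ℤ)) :
    GL (Fin 2) ℚ) • (OnePoint.infty : OnePoint ℚ) := rfl

/-- Unfolding `heckeNbrZero`. [cite: Shimura1971, §8.3 (8.3.2)] -/
theorem heckeNbrZero_def (hr : r.Prime) (x : OnePoint ℚ) : heckeNbrZero hr x =
    (Matrix.SpecialLinearGroup.mapGL ℚ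
      ((heckePermElt hr (cuspMatrix₁ x) (heckeIdxPre hr (cuspMatrix₁ x) (some 0)) : Gamma0 1) : SL(2, ℤ)) :
    GL (Fin 2) ℚ) • (OnePoint.infty : OnePoint ℚ) := rfl

end Neighbours


/-! ### Invariant functions, the boundary-symbol map, and shifts of symbols (appended 2026-08-28, p2 g4)

Vocabulary for the STATEMENT and proof of E-es-30 in generalised-eigen form: the `K`-module of `Γ₀(M)`-invariant
functions on `P¹(ℚ)` (`cuspInvariants M K` — finite-dimensional, ≅ `K^{Γ₀(M)\P¹(ℚ)}`), the boundary-symbol map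
`D w = ((a, b) ↦ w(b) − w(a))` (`boundaryOf K`; kernel = constants; `symbolHecke ∘ D = D ∘ cuspFunHecke` is
`symbolHecke_boundary`), and the precomposition of a symbol with a self-map of `P¹(ℚ)` in both arguments
(`symbolShift K n`, used with `n = heckeNbrInfty hr`, `heckeNbrZero hr`: the operators `ρ_r`, `ρ_r⁻¹` on symbols). -/

section Symbols

variable (M : ℕ) (K : Type*) [CommRing K]

/-- **The `Γ₀(M)`-invariant `K`-valued functions on `P¹(ℚ)`** (functions on the cusp classes `Γ₀(M)\P¹(ℚ)`), as a
submodule of all functions. [cite: Shimura1971, §1.6] -/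
def cuspInvariants : Submodule K (OnePoint ℚ → K) where
  carrier := {w | ∀ γ : Gamma0 M, ∀ x : OnePoint ℚ,
    w ((Matrix.SpecialLinearGroup.mapGL ℚ (γ : SL(2, ℤ)) : GL (Fin 2) ℚ) • x) = w x}
  add_mem' {w w'} hw hw' γ x := by
    simp only [Pi.add_apply, hw γ x, hw' γ x]
  zero_mem' γ x := rfl
  smul_mem' c {w} hw γ x := by
    simp only [Pi.smul_apply, hw γ x]

/-- Membership in `cuspInvariants`. [cite: Shimura1971, §1.6] -/
@[simp] theorem mem_cuspInvariants (w : OnePoint ℚ → K) : w ∈ cuspInvariants M K ↔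
    ∀ γ : Gamma0 M, ∀ x : OnePoint ℚ,
      w ((Matrix.SpecialLinearGroup.mapGL ℚ (γ : SL(2, ℤ)) : GL (Fin 2) ℚ) • x) = w x := Iff.rfl

/-- **The boundary-symbol map** `D : (P¹(ℚ) → K) → (P¹(ℚ)² → K)`, `D w (a, b) = w(b) − w(a)`: its image on
`Γ₀(M)`-invariant functions is the module of BOUNDARY symbols of level `M` (Stevens), its kernel the constants.
[cite: Shimura1971, §8.3] -/
def boundaryOf : (OnePoint ℚ → K) →ₗ[K] (OnePoint ℚ → OnePoint ℚ → K) where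
  toFun w a b := w b - w a
  map_add' w w' := by
    funext a b
    simp only [Pi.add_apply]
    ring
  map_smul' c w := by
    funext a b
    simp only [Pi.smul_apply, smul_eq_mul, RingHom.id_apply]
    ring

/-- Unfolding `boundaryOf`. [cite: Shimura1971, §8.3] -/
@[simp] theorem boundaryOf_apply (w : OnePoint ℚ → K) (a b : OnePoint ℚ) : boundaryOf K w a b = w b - w a := rfl

/-- **Shift of a symbol by a self-map of `P¹(ℚ)` in both arguments**: `(symbolShift K n Φ)(a, b) = Φ(n a, n b)` — with
`n = heckeNbrInfty hr` / `heckeNbrZero hr` these are the operators `ρ_r`, `ρ_r⁻¹` on symbols. [cite: Shimura1971, §8.3] -/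
def symbolShift (n : OnePoint ℚ → OnePoint ℚ) : Module.End K (OnePoint ℚ → OnePoint ℚ → K) where
  toFun Φ a b := Φ (n a) (n b)
  map_add' Φ Ψ := by
    funext a b
    simp only [Pi.add_apply]
  map_smul' c Φ := by
    funext a b
    simp only [Pi.smul_apply, RingHom.id_apply]

/-- Unfolding `symbolShift`. [cite: Shimura1971, §8.3] -/
@[simp] theorem symbolShift_apply (n : OnePoint ℚ → OnePoint ℚ) (Φ : OnePoint ℚ → OnePoint ℚ → K) (a b : OnePoint ℚ) :
    symbolShift K n Φ a b = Φ (n a) (n b) := rfl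

/-- `symbolShift` of a boundary symbol is the boundary symbol of the precomposed function. [cite: Shimura1971, §8.3] -/
theorem symbolShift_boundaryOf (n : OnePoint ℚ → OnePoint ℚ) (w : OnePoint ℚ → K) :
    symbolShift K n (boundaryOf K w) = boundaryOf K (w ∘ n) := rfl

end Symbols


/-! ### Parabolic elements at a cusp and their values under a homomorphism (appended 2026-08-28, p2 g4)

Vocabulary for N4 PARABOLICITY (MEMO-es §22.2 (0)): the parabolic element `g T^w g⁻¹` of `SL₂(ℤ)` attached to a matrix
`g` and an exponent `w` (Mathlib `ModularGroup.T`), and the cusp function `x ↦ u(g_x T^w g_x⁻¹)` (value of an additive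
map `u` on `Γ₀(L)` at the parabolic element of exponent `w` at the cusp `x`, `g_x = cuspMatrix x`; `0` when that element
is not in `Γ₀(L)`), on which the Hecke operators of `Hom(Γ₀(L), K)` act through the transposed cusp correspondence
`T♯_r = r ρ_r + ρ_r⁻¹` (downstream). -/

section Parabolic

/-- **The parabolic element `g T^w g⁻¹ ∈ SL₂(ℤ)`** (`T = (1 1; 0 1)`): it fixes the cusp `g∞`, and every element of
`SL₂(ℤ)` fixing `g∞` is `± g T^w g⁻¹` for some `w`. Its lower-left entry is `−w c²` (`c = g₁₀`), so it lies in `Γ₀(L)`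
iff `L ∣ w c²`. [cite: Shimura1971, §1.3] -/
def parabolicAt (g : SL(2, ℤ)) (w : ℤ) : SL(2, ℤ) :=
  g * ModularGroup.T ^ w * g⁻¹

/-- Unfolding `parabolicAt`. [cite: Shimura1971, §1.3] -/
theorem parabolicAt_def (g : SL(2, ℤ)) (w : ℤ) : parabolicAt g w = g * ModularGroup.T ^ w * g⁻¹ := rfl

variable (L : ℕ) (K : Type*) [CommRing K]

open Classical in
/-- **The cusp function of an additive map on `Γ₀(L)` at exponent `w`**: `x ↦ u(g_x T^w g_x⁻¹)` with `g_x = cuspMatrix x`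
when `g_x T^w g_x⁻¹ ∈ Γ₀(L)`, and `0` otherwise; linear in `u : Γ₀(L) → K¹` (the tree's degree-`0` cochains).  For `u` a
homomorphism it is `Γ₀(L)`-invariant in `x` (downstream). [cite: Shimura1971, §8.1 (8.1.4)] -/
def parabolicValue (w : ℤ) : (Gamma0 L → Fin 1 → K) →ₗ[K] (OnePoint ℚ → K) where
  toFun u x := if h : parabolicAt (cuspMatrix x) w ∈ Gamma0 L then u ⟨parabolicAt (cuspMatrix x) w, h⟩ 0 else 0
  map_add' u v := by
    funext x
    show (if h : parabolicAt (cuspMatrix x) w ∈ Gamma0 L then (u + v) ⟨parabolicAt (cuspMatrix x) w, h⟩ 0 else 0) =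
      (if h : parabolicAt (cuspMatrix x) w ∈ Gamma0 L then u ⟨parabolicAt (cuspMatrix x) w, h⟩ 0 else 0) +
      (if h : parabolicAt (cuspMatrix x) w ∈ Gamma0 L then v ⟨parabolicAt (cuspMatrix x) w, h⟩ 0 else 0)
    split_ifs
    · rfl
    · exact (add_zero _).symm
  map_smul' c u := by
    funext x
    show (if h : parabolicAt (cuspMatrix x) w ∈ Gamma0 L then (c • u) ⟨parabolicAt (cuspMatrix x) w, h⟩ 0 else 0) =
      c • (if h : parabolicAt (cuspMatrix x) w ∈ Gamma0 L then u ⟨parabolicAt (cuspMatrix x) w, h⟩ 0 else 0)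
    split_ifs
    · rfl
    · exact (smul_zero c).symm

open Classical in
/-- Unfolding `parabolicValue` when the parabolic element lies in `Γ₀(L)`. [cite: Shimura1971, §8.1 (8.1.4)] -/
theorem parabolicValue_apply_of_mem (w : ℤ) (u : Gamma0 L → Fin 1 → K) (x : OnePoint ℚ)
    (h : parabolicAt (cuspMatrix x) w ∈ Gamma0 L) :
    parabolicValue L K w u x = u ⟨parabolicAt (cuspMatrix x) w, h⟩ 0 := by
  show (if h : parabolicAt (cuspMatrix x) w ∈ Gamma0 L then u ⟨parabolicAt (cuspMatrix x) w, h⟩ 0 else 0) = _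
  rw [dif_pos h]

open Classical in
/-- Unfolding `parabolicValue` when the parabolic element does not lie in `Γ₀(L)`. [cite: Shimura1971, §8.1 (8.1.4)] -/
theorem parabolicValue_apply_of_not_mem (w : ℤ) (u : Gamma0 L → Fin 1 → K) (x : OnePoint ℚ)
    (h : parabolicAt (cuspMatrix x) w ∉ Gamma0 L) :
    parabolicValue L K w u x = 0 := by
  show (if h : parabolicAt (cuspMatrix x) w ∈ Gamma0 L then u ⟨parabolicAt (cuspMatrix x) w, h⟩ 0 else 0) = _
  rw [dif_neg h]

end Parabolic

end Summit.BirchSwinnertonDyer.BirchSwinnertonDyer.Theorems.ManinLocalTwoThree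

end
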